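import Literature.Analysis.OperatorTheory.TempleInequality
import Literature.Analysis.OperatorTheory.CompactSelfAdjointEigenbasis
import HarnessLib

/-!
# The Temple certificate: an interval-arithmetic form of Temple's lower bound for the bottom
# eigenvalue of a compact self-adjoint operator (Reed–Simon IV, Thm. XIII.5; Kato VI §4)

Topic `Analysis/OperatorTheory`; theorems only (no definition, no named fact, no instance).

`TempleInequality.lean` proves Temple's inequality for a symmetric map with a GIVEN Hilbert eigenbasis
and an EXACT Rayleigh quotient `ρ`, residual `‖Tx‖² - ρ²` and level `β ≤ λ₂`.  Certified numerics
deliver instead ENCLOSURES: `ρ ∈ [ρlo, ρhi]`, `‖Tx‖² ≤ α`, and a bound `h` on the *negative square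
mass over orthonormal eigenfamilies* (from a Hilbert–Schmidt norm, possibly after deflating the
positive part), from which `β` is produced by a rational inequality `h - d·ρhi² ≤ β²`, `β ≤ 0`, where
`d` is a known lower bound for the multiplicity of negative eigenvalues (`d = 2` for a doublet forced by
a symmetry).  This file packages exactly that bookkeeping, for a compact self-adjoint operator on a
Hilbert space (the eigenbasis is taken from `exists_hilbertBasis_eigenvectors_of_isSelfAdjoint`):

* `temple_bound_ge_min` — the certificate function `f(ρ) = (βρ - α)/(β - ρ)` is monotone on
  `(-∞, β)`, so `f(ρ) ≥ min (f ρlo) (f ρhi)` on `[ρlo, ρhi]`;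
* `orthonormal_fin_cons` — appending a unit vector orthogonal to an orthonormal family;
* `temple_certificate` — **the certificate**: under the hypotheses above there is a bottom
  eigenvalue `l ≤ ρhi` with `min (f ρlo) (f ρhi) ≤ l`, `l ‖y‖² ≤ Re⟪y, Ty⟫` for all `y`, and every other
  eigenvalue is `≥ β` (spectral gap), [cite: ReedSimonIV1978, Thm. XIII.5].

## References
* M. Reed, B. Simon, *Methods of Modern Mathematical Physics IV: Analysis of Operators* (1978),
  Thm. XIII.5 (Temple's inequality) [ReedSimonIV1978].
* T. Kato, *Perturbation Theory for Linear Operators* (1966), §VI.4 [Kato1966].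
-/

noncomputable section

open scoped InnerProductSpace ComplexConjugate
open Filter

namespace Literature.Analysis.OperatorTheory

variable {𝕜 : Type*} [RCLike 𝕜] {E : Type*} [NormedAddCommGroup E] [InnerProductSpace 𝕜 E]

/-- **Monotonicity of the Temple certificate function.** For `ρ ∈ [ρlo, ρhi]` with `ρhi < β`,
`min ((βρlo - α)/(β - ρlo)) ((βρhi - α)/(β - ρhi)) ≤ (βρ - α)/(β - ρ)`: indeed
`(βρ - α)/(β - ρ) = -β + (β² - α)/(β - ρ)` is monotone in `ρ` on `(-∞, β)` (increasing if `β² ≥ α`,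
decreasing otherwise). [folklore] -/
theorem temple_bound_ge_min {ρlo ρhi α β ρ : ℝ} (hlo : ρlo ≤ ρ) (hhi : ρ ≤ ρhi) (hβ : ρhi < β) :
    min ((β * ρlo - α) / (β - ρlo)) ((β * ρhi - α) / (β - ρhi)) ≤ (β * ρ - α) / (β - ρ) := by
  have key : ∀ r : ℝ, r < β → (β * r - α) / (β - r) = -β + (β ^ 2 - α) / (β - r) := by
    intro r hr
    have : β - r ≠ 0 := by linarith
    field_simp
    ring
  have hρβ : ρ < β := lt_of_le_of_lt hhi hβ
  have hloβ : ρlo < β := lt_of_le_of_lt hlo hρβ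
  rw [key ρlo hloβ, key ρhi hβ, key ρ hρβ]
  rcases le_or_gt 0 (β ^ 2 - α) with hpos | hneg
  · refine (min_le_left _ _).trans ?_
    have : (β ^ 2 - α) / (β - ρlo) ≤ (β ^ 2 - α) / (β - ρ) :=
      div_le_div_of_nonneg_left hpos (by linarith) (by linarith)
    linarith
  · refine (min_le_right _ _).trans ?_
    have : (β ^ 2 - α) / (β - ρhi) ≤ (β ^ 2 - α) / (β - ρ) := by
      rw [div_le_div_iff₀ (by linarith) (by linarith)]
      nlinarith
    linarith

/-- Appending a unit vector orthogonal to an orthonormal family gives an orthonormal family.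
[folklore] -/
theorem orthonormal_fin_cons {d : ℕ} {u : E} {w : Fin d → E} (hu : ‖u‖ = 1) (hw : Orthonormal 𝕜 w)
    (huw : ∀ j, ⟪w j, u⟫_𝕜 = 0) : Orthonormal 𝕜 (Fin.cons u w : Fin (d + 1) → E) := by
  rw [orthonormal_iff_ite]
  have hw' := orthonormal_iff_ite.1 hw
  intro i j
  refine Fin.cases ?_ (fun i => ?_) i <;> refine Fin.cases ?_ (fun j => ?_) j
  · simp only [Fin.cons_zero, ↓reduceIte]
    rw [inner_self_eq_norm_sq_to_K, hu]
    simp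
  · simp only [Fin.cons_zero, Fin.cons_succ]
    rw [if_neg (Fin.succ_ne_zero j).symm, ← inner_conj_symm, huw j, map_zero]
  · simp only [Fin.cons_zero, Fin.cons_succ]
    rw [if_neg (Fin.succ_ne_zero i), huw i]
  · simp only [Fin.cons_succ]
    rw [hw' i j]
    by_cases hij : i = j
    · subst hij; simp
    · rw [if_neg hij, if_neg (fun h => hij (Fin.succ_inj.1 h))]

variable [CompleteSpace E]

/-- **The Temple certificate (interval form of Temple's inequality with a square-mass level).**
Let `T` be a compact self-adjoint operator on a Hilbert space; `d ≥ 1` a lower bound for the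
multiplicity of its negative eigenvalues (every eigenvector with eigenvalue `c < 0` is a member of some
orthonormal `d`-family of eigenvectors for `c`); `h` a bound for the negative square mass
`Σ_j c_j²` over every finite orthonormal family of eigenvectors with negative eigenvalues `c_j`; `x` a
unit vector with `ρlo ≤ Re⟪x,Tx⟫ ≤ ρhi < 0` and `‖Tx‖² ≤ α`; and `β ≤ 0` with `h - d ρhi² ≤ β²` and
`ρhi < β`.  Then the bottom of the spectrum is an eigenvalue `l ≤ ρhi`, every `y` satisfies
`l ‖y‖² ≤ Re⟪y,Ty⟫`, every eigenvalue other than `l` is `≥ β`, and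
`min ((βρlo - α)/(β - ρlo)) ((βρhi - α)/(β - ρhi)) ≤ l` (Ritz: some eigenvalue `l ≤ ρ`; square mass:
a second negative eigenvalue `c ≠ l` would give `d l² + c² ≤ h`, so `c ≥ β`; Temple's division-free core
with the gap `(l, β)`; monotonicity of the certificate function); moreover (Kato's enclosure of the trial
vector) `x` is within `√((α - ρhi²)/(β - ρhi)²)` of the `l`-eigenspace, and an orthonormal `m`-family of
`l`-eigenvectors forces `m ρhi² ≤ h` (so the multiplicity of `l` is `≤ d` as soon as `h < (d+1) ρhi²`).
[cite: ReedSimonIV1978, Thm. XIII.5] -/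
theorem temple_certificate {T : E →L[𝕜] E} (hT : IsCompactOperator T) (hsa : IsSelfAdjoint T)
    {d : ℕ} (hd : 1 ≤ d)
    (hmult : ∀ (c : ℝ) (v : E), c < 0 → v ≠ 0 → T v = (c : 𝕜) • v →
      ∃ w : Fin d → E, Orthonormal 𝕜 w ∧ ∀ j, T (w j) = (c : 𝕜) • w j)
    {h : ℝ} (hsq : ∀ (m : ℕ) (w : Fin m → E) (c : Fin m → ℝ), Orthonormal 𝕜 w →
      (∀ j, c j < 0 ∧ T (w j) = (c j : 𝕜) • w j) → ∑ j, c j ^ 2 ≤ h)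
    {x : E} (hx : ‖x‖ = 1) {ρlo ρhi α β : ℝ}
    (hρlo : ρlo ≤ RCLike.re ⟪x, T x⟫_𝕜) (hρhi : RCLike.re ⟪x, T x⟫_𝕜 ≤ ρhi) (hρhi0 : ρhi < 0)
    (hα : ‖T x‖ ^ 2 ≤ α) (hβ0 : β ≤ 0) (hβ : h - d * ρhi ^ 2 ≤ β ^ 2) (hρβ : ρhi < β) :
    ∃ l : ℝ, (∃ v : E, v ≠ 0 ∧ T v = (l : 𝕜) • v) ∧ l ≤ ρhi ∧
      min ((β * ρlo - α) / (β - ρlo)) ((β * ρhi - α) / (β - ρhi)) ≤ l ∧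
      (∀ y : E, l * ‖y‖ ^ 2 ≤ RCLike.re ⟪y, T y⟫_𝕜) ∧
      (∀ (c : ℝ) (v : E), v ≠ 0 → T v = (c : 𝕜) • v → c = l ∨ β ≤ c) ∧
      (∃ v : E, T v = (l : 𝕜) • v ∧ ‖x - v‖ ^ 2 ≤ (α - ρhi ^ 2) / (β - ρhi) ^ 2) ∧
      (∀ (m : ℕ) (w : Fin m → E), Orthonormal 𝕜 w → (∀ j, T (w j) = (l : 𝕜) • w j) →
        (m : ℝ) * ρhi ^ 2 ≤ h) := by
  obtain ⟨s, b, κ, -, hTb⟩ := exists_hilbertBasis_eigenvectors_of_isSelfAdjoint hT hsa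
  have hsym : ∀ x y : E, ⟪T x, y⟫_𝕜 = ⟪x, T y⟫_𝕜 :=
    (ContinuousLinearMap.isSelfAdjoint_iff_isSymmetric.1 hsa)
  set ρ := RCLike.re ⟪x, T x⟫_𝕜 with hρdef
  -- Ritz: an eigenvalue below `ρ`
  obtain ⟨i₀, -, hi₀⟩ := exists_eigenvalue_le_rayleigh b hsym hTb hx
  set l := κ i₀ with hldef
  have hlρhi : l ≤ ρhi := hi₀.trans hρhi
  have hl0 : l < 0 := lt_of_le_of_lt hlρhi hρhi0
  have hbi₀ : (b i₀ : E) ≠ 0 := by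
    intro h0
    have := b.orthonormal.norm_eq_one i₀
    rw [h0, norm_zero] at this
    exact zero_ne_one this
  -- the gap: every eigenvalue is `l` or `≥ β`
  have hgap : ∀ (c : ℝ) (v : E), v ≠ 0 → T v = (c : 𝕜) • v → c = l ∨ β ≤ c := by
    intro c v hv hTv
    by_cases hc0 : 0 ≤ c
    · exact Or.inr (hβ0.trans hc0)
    push Not at hc0
    by_cases hcl : c = l
    · exact Or.inl hcl
    right
    -- the `d`-family for `l` and the normalised `v`
    obtain ⟨w, hw, hTw⟩ := hmult l (b i₀) hl0 hbi₀ (hTb i₀)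
    obtain ⟨u, hu, hTu⟩ : ∃ u : E, ‖u‖ = 1 ∧ T u = (c : 𝕜) • u := by
      have hvn : ‖v‖ ≠ 0 := norm_ne_zero_iff.2 hv
      refine ⟨((‖v‖⁻¹ : ℝ) : 𝕜) • v, ?_, ?_⟩
      · rw [norm_smul, RCLike.norm_ofReal, abs_of_nonneg (inv_nonneg.2 (norm_nonneg _)),
          inv_mul_cancel₀ hvn]
      · rw [map_smul, hTv, smul_comm]
    have huw : ∀ j, ⟪w j, u⟫_𝕜 = 0 := by
      intro j
      have h1 := hsym (w j) u
      rw [hTw j, hTu, inner_smul_left, inner_smul_right, RCLike.conj_ofReal] at h1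
      have h2 : ((l : 𝕜) - (c : 𝕜)) * ⟪w j, u⟫_𝕜 = 0 := by rw [sub_mul, h1, sub_self]
      rcases mul_eq_zero.1 h2 with h3 | h3
      · exfalso
        apply hcl
        have : (l : 𝕜) = (c : 𝕜) := sub_eq_zero.1 h3
        exact (RCLike.ofReal_injective this).symm
      · exact h3
    have hW : Orthonormal 𝕜 (Fin.cons u w : Fin (d + 1) → E) := orthonormal_fin_cons hu hw huw
    have hsum := hsq (d + 1) (Fin.cons u w) (Fin.cons c fun _ => l) hW (by
      intro j
      refine Fin.cases ?_ (fun j => ?_) j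
      · simp only [Fin.cons_zero]; exact ⟨hc0, hTu⟩
      · simp only [Fin.cons_succ]; exact ⟨hl0, hTw j⟩)
    simp only [Fin.sum_univ_succ, Fin.cons_zero, Fin.cons_succ, Finset.sum_const, Finset.card_univ,
      Fintype.card_fin, nsmul_eq_mul] at hsum
    -- `c² ≤ h - d l² ≤ h - d ρhi² ≤ β²`
    have hl2 : ρhi ^ 2 ≤ l ^ 2 := by nlinarith
    have hd' : (1 : ℝ) ≤ d := by exact_mod_cast hd
    have hdl : (d : ℝ) * ρhi ^ 2 ≤ d * l ^ 2 := mul_le_mul_of_nonneg_left hl2 (by linarith)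
    have hc2 : c ^ 2 ≤ β ^ 2 := by linarith
    by_contra hlt
    push Not at hlt
    nlinarith [mul_pos (sub_pos.2 hlt) (by linarith : 0 < -(c + β))]
  -- `l` is the bottom of the spectrum
  have hmin : ∀ i, l ≤ κ i := by
    intro i
    have hbi : (b i : E) ≠ 0 := by
      intro h0
      have := b.orthonormal.norm_eq_one i
      rw [h0, norm_zero] at this
      exact zero_ne_one this
    rcases hgap (κ i) (b i) hbi (hTb i) with h1 | h1
    · exact h1.ge
    · exact (hlρhi.trans hρβ.le).trans h1
  have hray : ∀ y : E, l * ‖y‖ ^ 2 ≤ RCLike.re ⟪y, T y⟫_𝕜 := by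
    intro y
    have h0 := hasSum_norm_inner_sq b y
    have h1 := hasSum_eigen_norm_sq b hsym hTb y
    have hle : ∀ i, l * ‖⟪b i, y⟫_𝕜‖ ^ 2 ≤ κ i * ‖⟪b i, y⟫_𝕜‖ ^ 2 := fun i =>
      mul_le_mul_of_nonneg_right (hmin i) (sq_nonneg _)
    exact hasSum_le hle (h0.mul_left l) h1
  -- Temple's core inequality with the gap `(l, β)`
  have hgap' : ∀ i, κ i ≤ l ∨ β ≤ κ i := by
    intro i
    have hbi : (b i : E) ≠ 0 := by
      intro h0
      have := b.orthonormal.norm_eq_one i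
      rw [h0, norm_zero] at this
      exact zero_ne_one this
    rcases hgap (κ i) (b i) hbi (hTb i) with h1 | h1
    · exact Or.inl h1.le
    · exact Or.inr h1
  have hlβ : l ≤ β := hlρhi.trans hρβ.le
  have hcore := temple_core b hsym hTb hgap' hlβ x
  rw [hx, one_pow, mul_one] at hcore
  have hρβ' : ρ < β := lt_of_le_of_lt hρhi hρβ
  have hlow : (β * ρ - α) / (β - ρ) ≤ l := by
    rw [div_le_iff₀ (sub_pos.2 hρβ')]
    nlinarith
  -- multiplicity mass
  have hmass : ∀ (m : ℕ) (w : Fin m → E), Orthonormal 𝕜 w → (∀ j, T (w j) = (l : 𝕜) • w j) →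
      (m : ℝ) * ρhi ^ 2 ≤ h := by
    intro m w hw hTw
    have h1 := hsq m w (fun _ => l) hw (fun j => ⟨hl0, hTw j⟩)
    simp only [Finset.sum_const, Finset.card_univ, Fintype.card_fin, nsmul_eq_mul] at h1
    have hl2 : ρhi ^ 2 ≤ l ^ 2 := by nlinarith
    nlinarith [mul_le_mul_of_nonneg_left hl2 (Nat.cast_nonneg m)]
  -- Kato enclosure: project `x` onto the `l`-eigenspace
  have hkato : ∃ v : E, T v = (l : 𝕜) • v ∧ ‖x - v‖ ^ 2 ≤ (α - ρhi ^ 2) / (β - ρhi) ^ 2 := by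
    set K : Submodule 𝕜 E := Module.End.eigenspace (T : Module.End 𝕜 E) (l : 𝕜) with hK
    haveI : CompleteSpace K := (isClosed_eigenspace T (l : 𝕜)).completeSpace_coe
    refine ⟨K.starProjection x, ?_, ?_⟩
    · have hm : K.starProjection x ∈ K := K.starProjection_apply_mem x
      exact Module.End.mem_eigenspace_iff.1 hm
    · -- coefficients of `x - P_K x` in the eigenbasis
      have horth : x - K.starProjection x ∈ Kᗮ := K.sub_starProjection_mem_orthogonal x
      have hcoef : ∀ i, ‖⟪b i, x - K.starProjection x⟫_𝕜‖ ^ 2 =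
          if κ i = l then 0 else ‖⟪b i, x⟫_𝕜‖ ^ 2 := by
        intro i
        by_cases hil : κ i = l
        · rw [if_pos hil]
          have hbK : (b i : E) ∈ K := by
            rw [hK, Module.End.mem_eigenspace_iff]
            simpa [hil] using hTb i
          rw [(Submodule.mem_orthogonal K _).1 horth (b i) hbK]
          simp
        · rw [if_neg hil, inner_sub_right]
          have hv : K.starProjection x ∈ K := K.starProjection_apply_mem x
          have hTv : T (K.starProjection x) = (l : 𝕜) • K.starProjection x :=
            Module.End.mem_eigenspace_iff.1 hv
          have h1 := hsym (b i) (K.starProjection x)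
          rw [hTb i, hTv, inner_smul_left, inner_smul_right, RCLike.conj_ofReal] at h1
          have h2 : ((κ i : 𝕜) - (l : 𝕜)) * ⟪b i, K.starProjection x⟫_𝕜 = 0 := by
            rw [sub_mul, h1, sub_self]
          rcases mul_eq_zero.1 h2 with h3 | h3
          · exact absurd (RCLike.ofReal_injective (sub_eq_zero.1 h3)) hil
          · rw [h3, sub_zero]
      have hpars := hasSum_norm_inner_sq b (x - K.starProjection x)
      refine hasSum_le_of_sum_le hpars fun t => ?_
      classical
      rw [Finset.sum_congr rfl fun i _ => hcoef i, Finset.sum_ite, Finset.sum_const_zero, zero_add]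
      -- Kato on the finite set of indices with `κ i ≠ l`, all `≥ β`
      have hs : ∀ i ∈ t.filter (fun i => ¬κ i = l), β ≤ κ i := by
        intro i hi
        rw [Finset.mem_filter] at hi
        rcases hgap' i with h1 | h1
        · exact absurd (le_antisymm h1 (hmin i)) hi.2
        · exact h1
      have hρβle : ρ ≤ β := hρβ'.le
      have hK2 := sum_coeff_sq_upper_le b hsym hTb hgap' hx (t.filter fun i => ¬κ i = l) hs hi₀ hρβle
      have hD : (β - ρhi) ^ 2 ≤ (β - l) * (β - ρ) := by
        have h1 : β - ρhi ≤ β - l := by linarith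
        have h2 : β - ρhi ≤ β - ρ := by linarith
        nlinarith [mul_le_mul h1 h2 (by linarith) (by linarith)]
      have hD0 : 0 < (β - ρhi) ^ 2 := by positivity
      have hN : ‖T x‖ ^ 2 - ρ ^ 2 ≤ α - ρhi ^ 2 := by nlinarith
      have hS0 : 0 ≤ ∑ i ∈ t.filter (fun i => ¬κ i = l), ‖⟪b i, x⟫_𝕜‖ ^ 2 :=
        Finset.sum_nonneg fun i _ => sq_nonneg _
      rw [le_div_iff₀ hD0]
      nlinarith [mul_le_mul_of_nonneg_left hD hS0]
  refine ⟨l, ⟨b i₀, hbi₀, hTb i₀⟩, hlρhi, (temple_bound_ge_min hρlo hρhi hρβ).trans hlow, hray, hgap,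
    hkato, hmass⟩

end Literature.Analysis.OperatorTheory

end
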